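import Summits.Ventures.Crystal3D.Theorems.StickyWulffConstantTextureLiminfCubeRigidityLocalLayers
import HarnessLib

/-!
# Cube rigidity I′ — LOCAL hexagonal layers: the layer above and the layer below a layer disc
# (lane T, crux `TextureLiminf`, stmt-Ventures-19483; registered line `TexShadow`, named core `CubeRigidity` of `stub_resolution`)

HONEST FRAMING. Venture `Summits/Ventures/Crystal3D` (cell `crystal3d-full`), helper `--supports` the crux `TextureLiminf`
(stmt-Ventures-19483) of `route-Ventures-StickyWulffConstant`, registered line `TexShadow`.  Rung credit only; F-C1 not moved.
Sequel of `…CubeRigidityLocalLayers` (Hales's normalisation, frame `u₁ u₂ w h e₃` of `LayerShells.lean`).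

* `upper_type_eq` / `lower_type_eq` — the upper (lower) type of a layer shell at `Q` is `1` iff the site `Q + w ± h e₃` is a centre.
* `LayerDisc.hexagon` — the six hexagon neighbours of a disc point of radius `n − 2` are disc points of radius `n`.
* `layerDisc_up` / `layerDisc_down` — from `LayerDisc V c τ τ' n`, with FCC/HCP arrangements at the neighbours of the disc's
  centres, the layer above, `LayerDisc V (c + τ w + h e₃) ρ (−τ) (n − 2)`, resp. below, `LayerDisc V (c + τ' w − h e₃) (−τ') ρ' (n − 2)`,
  for ONE outer type (`L2B.upper_shell` / `lower_shell` at every point; `L2B.types_eq_of_adjacent` along the four unit moves).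
WHAT THIS IS NOT: not yet the stacking / no-room / `CubeRigidity`; F-C1 not moved.
-/

noncomputable section

namespace Summit.Ventures.Crystal3D.Theorems.LocalStacking

open Literature.Geometry.DiscreteGeometry Literature.MathematicalPhysics.StatisticalMechanics
open RealInnerProductSpace Summit.Ventures.Crystal3D.L2B


variable {V : Set (EuclideanSpace ℝ (Fin 3))}

/-! ## Type detectors -/

/-- `‖w + h e₃‖ = 2`. -/
theorem inner_self_frameW_add_frameE : ⟪(barlowOffset (2 : ℝ)) + layerNormal layerSpacing, barlowOffset (2 : ℝ) + layerNormal layerSpacing⟫ = 4 := by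
  simp only [inner_add_left, inner_add_right, inner_frameW_frameW, inner_frameW_frameE, inner_frameE_frameW,
    inner_frameE_frameE]; norm_num

/-- `‖w − h e₃‖ = 2`. -/
theorem inner_self_frameW_sub_frameE : ⟪(barlowOffset (2 : ℝ)) - layerNormal layerSpacing, barlowOffset (2 : ℝ) - layerNormal layerSpacing⟫ = 4 := by
  simp only [inner_sub_left, inner_sub_right, inner_frameW_frameW, inner_frameW_frameE, inner_frameE_frameW,
    inner_frameE_frameE]; norm_num

open scoped Classical in
/-- **The upper type of a layer shell is read off one site**: `ρ = 1` iff the centre `Q + w + h e₃` is present. -/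
theorem upper_type_eq {Q : (EuclideanSpace ℝ (Fin 3))} {ρ ρ' : ℝ} (hρ : ρ = 1 ∨ ρ = -1) (hQ : kissingShell V Q = layerShell ρ ρ') :
    ρ = if Q + (barlowOffset (2 : ℝ) + layerNormal layerSpacing) ∈ V then 1 else -1 := by
  rcases hρ with rfl | rfl
  · have hm : (barlowOffset (2 : ℝ)) + layerNormal layerSpacing ∈ kissingShell V Q :=
      hQ ▸ mem_layerShell_iff.2 (Or.inr (Or.inl (by simp [holeTriple])))
    rw [if_pos hm.1]
  · have hm : Q + (barlowOffset (2 : ℝ) + layerNormal layerSpacing) ∉ V := by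
      intro h
      have hmem : (barlowOffset (2 : ℝ)) + layerNormal layerSpacing ∈ kissingShell V Q := ⟨h, norm_eq_two_iff_inner.2 inner_self_frameW_add_frameE⟩
      rw [hQ] at hmem
      rcases mem_layerShell_iff.1 hmem with h1 | h1 | h1
      · have := apply_two_of_mem_hexagonSet h1
        simp only [PiLp.add_apply, frameW_apply_two, frameE_apply_two] at this; linarith [layerSpacing_pos]
      · rw [add_sub_cancel_right] at h1
        exact not_mem_holeTriple_neg (σ := 1) (Or.inl rfl) (show (barlowOffset (2 : ℝ)) ∈ holeTriple 1 by simp [holeTriple])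
          (by simpa using h1)
      · have := apply_two_of_mem_holeTriple h1
        simp only [PiLp.add_apply, frameW_apply_two, frameE_apply_two] at this; linarith [layerSpacing_pos]
    rw [if_neg hm]

open scoped Classical in
/-- **The lower type of a layer shell is read off one site**: `ρ' = 1` iff the centre `Q + w − h e₃` is present. -/
theorem lower_type_eq {Q : (EuclideanSpace ℝ (Fin 3))} {ρ ρ' : ℝ} (hρ' : ρ' = 1 ∨ ρ' = -1) (hQ : kissingShell V Q = layerShell ρ ρ') :
    ρ' = if Q + (barlowOffset (2 : ℝ) - layerNormal layerSpacing) ∈ V then 1 else -1 := by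
  rcases hρ' with rfl | rfl
  · have hm : (barlowOffset (2 : ℝ)) - layerNormal layerSpacing ∈ kissingShell V Q :=
      hQ ▸ mem_layerShell_iff.2 (Or.inr (Or.inr (by simp [holeTriple])))
    rw [if_pos hm.1]
  · have hm : Q + (barlowOffset (2 : ℝ) - layerNormal layerSpacing) ∉ V := by
      intro h
      have hmem : (barlowOffset (2 : ℝ)) - layerNormal layerSpacing ∈ kissingShell V Q := ⟨h, norm_eq_two_iff_inner.2 inner_self_frameW_sub_frameE⟩
      rw [hQ] at hmem
      rcases mem_layerShell_iff.1 hmem with h1 | h1 | h1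
      · have := apply_two_of_mem_hexagonSet h1
        simp only [PiLp.sub_apply, frameW_apply_two, frameE_apply_two] at this; linarith [layerSpacing_pos]
      · have := apply_two_of_mem_holeTriple h1
        simp only [PiLp.sub_apply, frameW_apply_two, frameE_apply_two] at this; linarith [layerSpacing_pos]
      · rw [sub_add_cancel] at h1
        exact not_mem_holeTriple_neg (σ := 1) (Or.inl rfl) (show (barlowOffset (2 : ℝ)) ∈ holeTriple 1 by simp [holeTriple])
          (by simpa using h1)
    rw [if_neg hm]

/-! ## Neighbour indices stay in the next disc -/

/-- `|i + 1| ≤ |i| + 1`. -/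
theorem abs_add_one_le (i : ℤ) : |i + 1| ≤ |i| + 1 := by
  have := abs_add_le i 1; simpa using this

/-- `|i - 1| ≤ |i| + 1`. -/
theorem abs_sub_one_le (i : ℤ) : |i - 1| ≤ |i| + 1 := by
  have := abs_sub i 1; simpa using this

/-- The six hexagon neighbours of a disc point of ℓ¹-radius `n − 2` lie in the disc of radius `n`, with the corresponding
shells; stated for a layer datum. -/
theorem LayerDisc.hexagon {c : (EuclideanSpace ℝ (Fin 3))} {τ τ' : ℝ} {n : ℤ} (hL : LayerDisc V c τ τ' n) {i j : ℤ} (hij : |i| + |j| ≤ n - 2) :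
    ∀ η ∈ hexagonSet, c + latPt i j + η ∈ V ∧ kissingShell V (c + latPt i j + η) = layerShell τ τ' := by
  have h1 := abs_add_one_le i; have h2 := abs_sub_one_le i; have h3 := abs_add_one_le j; have h4 := abs_sub_one_le j
  intro η hη
  simp only [hexagonSet, Set.mem_insert_iff, Set.mem_singleton_iff] at hη
  rcases hη with rfl | rfl | rfl | rfl | rfl | rfl
  · rw [add_assoc, ← latPt_succ_left]; exact hL _ _ (by omega)
  · rw [add_assoc, ← latPt_pred_left]; exact hL _ _ (by omega)
  · rw [add_assoc, ← latPt_succ_right]; exact hL _ _ (by omega)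
  · rw [add_assoc, ← latPt_pred_right]; exact hL _ _ (by omega)
  · rw [add_assoc, ← latPt_succ_pred]; exact hL _ _ (by omega)
  · rw [add_assoc, ← latPt_pred_succ]; exact hL _ _ (by omega)

/-! ## The layer above and the layer below -/

/-- **The layer above, locally.** From a layer datum of radius `n` with types `(τ, τ')`, whose centres' neighbours all have
FCC/HCP tangent arrangements, the layer `c + τ w + h e₃ + Λ` is present to radius `n − 2` with shells `layerShell ρ (−τ)`
for ONE sign `ρ`. -/
theorem layerDisc_up (hV : IsUnitBallPacking V) {c : (EuclideanSpace ℝ (Fin 3))} {τ τ' : ℝ} (hτ : τ = 1 ∨ τ = -1) {n : ℤ}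
    (hL : LayerDisc V c τ τ' n)
    (hcp : ∀ i j : ℤ, |i| + |j| ≤ n → ∀ y ∈ kissingShell V (c + latPt i j),
      IsArrangedIn (kissingShell V (c + latPt i j + y)) fccKissingPattern ∨
        IsArrangedIn (kissingShell V (c + latPt i j + y)) hcpKissingPattern) :
    ∃ ρ : ℝ, (ρ = 1 ∨ ρ = -1) ∧ LayerDisc V (c + (τ • barlowOffset (2 : ℝ) + layerNormal layerSpacing)) ρ (-τ) (n - 2) := by
  classical
  have hmτ : (-τ = 1 ∨ -τ = -1) := by rcases hτ with rfl | rfl <;> norm_num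
  set c' : (EuclideanSpace ℝ (Fin 3)) := c + (τ • barlowOffset (2 : ℝ) + layerNormal layerSpacing) with hc'
  -- every point of the new disc is a polar ball of a fully ringed point of the old disc
  have point : ∀ i j : ℤ, |i| + |j| ≤ n - 2 → c' + latPt i j ∈ V ∧
      ∃ ρ : ℝ, (ρ = 1 ∨ ρ = -1) ∧ kissingShell V (c' + latPt i j) = layerShell ρ (-τ) := by
    intro i j hij
    set B : (EuclideanSpace ℝ (Fin 3)) := c + latPt i j with hB
    obtain ⟨hBV, hBS⟩ := hL i j (by omega)
    have hW : IsUnitBallPacking {z | B + z ∈ V} := isUnitBallPacking_translate hV B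
    have hW0 : (0 : (EuclideanSpace ℝ (Fin 3))) ∈ {z | B + z ∈ V} := by simpa using hBV
    have hWS : kissingShell {z | B + z ∈ V} 0 = layerShell τ τ' := by rw [kissingShell_translate, add_zero, hBS]
    have hring : ∀ η ∈ hexagonSet, kissingShell {z | B + z ∈ V} η = layerShell τ τ' := fun η hη => by
      rw [kissingShell_translate]; exact (hL.hexagon hij η hη).2
    have hcp1 : ∀ y ∈ kissingShell {z | B + z ∈ V} 0,
        IsArrangedIn (kissingShell {z | B + z ∈ V} y) fccKissingPattern ∨
          IsArrangedIn (kissingShell {z | B + z ∈ V} y) hcpKissingPattern := fun y hy => by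
      rw [kissingShell_translate, add_zero] at hy
      rw [kissingShell_translate]
      exact hcp i j (by omega) y hy
    have ht : τ • (barlowOffset (2 : ℝ)) + layerNormal layerSpacing - layerNormal layerSpacing ∈ holeTriple τ := by simp [holeTriple]
    obtain ⟨ρ, hρ, hS⟩ := upper_shell hW hW0 hτ hWS hring hcp1 ht
    rw [kissingShell_translate] at hS
    have e : B + (τ • barlowOffset (2 : ℝ) + layerNormal layerSpacing) = c' + latPt i j := by rw [hB, hc']; abel
    have hmem : τ • (barlowOffset (2 : ℝ)) + layerNormal layerSpacing ∈ kissingShell {z | B + z ∈ V} 0 :=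
      hWS ▸ mem_layerShell_iff.2 (Or.inr (Or.inl ht))
    have hmem' : B + (τ • barlowOffset (2 : ℝ) + layerNormal layerSpacing) ∈ V := by simpa using hmem.1
    exact ⟨e ▸ hmem', ρ, hρ, e ▸ hS⟩
  -- the common outer type
  set ρ₀ : ℝ := if c' + (barlowOffset (2 : ℝ) + layerNormal layerSpacing) ∈ V then 1 else -1 with hρ₀def
  have hρ₀ : ρ₀ = 1 ∨ ρ₀ = -1 := by rw [hρ₀def]; split_ifs <;> simp
  refine ⟨ρ₀, hρ₀, ?_⟩
  have key : ∀ i j : ℤ, |i| + |j| ≤ n - 2 → kissingShell V (c' + latPt i j) = layerShell ρ₀ (-τ) := by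
    by_cases h00 : (0 : ℤ) ≤ n - 2
    swap
    · intro i j hij; exfalso; have := abs_nonneg i; have := abs_nonneg j; omega
    refine disc_induction (n - 2) ?_ ?_
    · obtain ⟨-, ρ, hρ, hS⟩ := point 0 0 (by simpa using h00)
      rw [hS, upper_type_eq hρ hS, latPt_zero, add_zero]
    · intro i j hij hS
      have h1 := abs_add_one_le i; have h2 := abs_sub_one_le i; have h3 := abs_add_one_le j; have h4 := abs_sub_one_le j
      refine ⟨?_, ?_, ?_, ?_⟩
      · obtain ⟨-, ρ, hρ, hS'⟩ := point (i + 1) j (by omega)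
        rw [latPt_succ_left, ← add_assoc] at hS' ⊢
        rw [hS', (types_eq_of_adjacent hV (Or.inl rfl) hρ₀ hmτ hρ hmτ hS hS').1]
      · obtain ⟨-, ρ, hρ, hS'⟩ := point (i - 1) j (by omega)
        have e : c' + latPt (i - 1) j + triangularVec₁ (2 : ℝ) = c' + latPt i j := by rw [latPt_pred_left]; abel
        rw [hS', ← (types_eq_of_adjacent hV (Or.inl rfl) hρ hmτ hρ₀ hmτ hS' (e.symm ▸ hS)).1]
      · obtain ⟨-, ρ, hρ, hS'⟩ := point i (j + 1) (by omega)
        rw [latPt_succ_right, ← add_assoc] at hS' ⊢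
        rw [hS', (types_eq_of_adjacent hV (Or.inr rfl) hρ₀ hmτ hρ hmτ hS hS').1]
      · obtain ⟨-, ρ, hρ, hS'⟩ := point i (j - 1) (by omega)
        have e : c' + latPt i (j - 1) + triangularVec₂ (2 : ℝ) = c' + latPt i j := by rw [latPt_pred_right]; abel
        rw [hS', ← (types_eq_of_adjacent hV (Or.inr rfl) hρ hmτ hρ₀ hmτ hS' (e.symm ▸ hS)).1]
  exact fun i j h => ⟨(point i j h).1, key i j h⟩

/-- **The layer below, locally.** From a layer datum of radius `n` with types `(τ, τ')`, whose centres' neighbours all have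
FCC/HCP tangent arrangements, the layer `c + τ' w − h e₃ + Λ` is present to radius `n − 2` with shells `layerShell (−τ') ρ'`
for ONE sign `ρ'`. -/
theorem layerDisc_down (hV : IsUnitBallPacking V) {c : (EuclideanSpace ℝ (Fin 3))} {τ τ' : ℝ} (hτ' : τ' = 1 ∨ τ' = -1) {n : ℤ}
    (hL : LayerDisc V c τ τ' n)
    (hcp : ∀ i j : ℤ, |i| + |j| ≤ n → ∀ y ∈ kissingShell V (c + latPt i j),
      IsArrangedIn (kissingShell V (c + latPt i j + y)) fccKissingPattern ∨
        IsArrangedIn (kissingShell V (c + latPt i j + y)) hcpKissingPattern) :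
    ∃ ρ' : ℝ, (ρ' = 1 ∨ ρ' = -1) ∧ LayerDisc V (c + (τ' • barlowOffset (2 : ℝ) - layerNormal layerSpacing)) (-τ') ρ' (n - 2) := by
  classical
  have hmτ : (-τ' = 1 ∨ -τ' = -1) := by rcases hτ' with rfl | rfl <;> norm_num
  set c' : (EuclideanSpace ℝ (Fin 3)) := c + (τ' • barlowOffset (2 : ℝ) - layerNormal layerSpacing) with hc'
  have point : ∀ i j : ℤ, |i| + |j| ≤ n - 2 → c' + latPt i j ∈ V ∧
      ∃ ρ' : ℝ, (ρ' = 1 ∨ ρ' = -1) ∧ kissingShell V (c' + latPt i j) = layerShell (-τ') ρ' := by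
    intro i j hij
    set B : (EuclideanSpace ℝ (Fin 3)) := c + latPt i j with hB
    obtain ⟨hBV, hBS⟩ := hL i j (by omega)
    have hW : IsUnitBallPacking {z | B + z ∈ V} := isUnitBallPacking_translate hV B
    have hW0 : (0 : (EuclideanSpace ℝ (Fin 3))) ∈ {z | B + z ∈ V} := by simpa using hBV
    have hWS : kissingShell {z | B + z ∈ V} 0 = layerShell τ τ' := by rw [kissingShell_translate, add_zero, hBS]
    have hring : ∀ η ∈ hexagonSet, kissingShell {z | B + z ∈ V} η = layerShell τ τ' := fun η hη => by
      rw [kissingShell_translate]; exact (hL.hexagon hij η hη).2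
    have hcp1 : ∀ y ∈ kissingShell {z | B + z ∈ V} 0,
        IsArrangedIn (kissingShell {z | B + z ∈ V} y) fccKissingPattern ∨
          IsArrangedIn (kissingShell {z | B + z ∈ V} y) hcpKissingPattern := fun y hy => by
      rw [kissingShell_translate, add_zero] at hy
      rw [kissingShell_translate]
      exact hcp i j (by omega) y hy
    have ht : τ' • (barlowOffset (2 : ℝ)) - layerNormal layerSpacing + layerNormal layerSpacing ∈ holeTriple τ' := by simp [holeTriple]
    obtain ⟨ρ', hρ', hS⟩ := lower_shell hW hW0 hτ' hWS hring hcp1 ht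
    rw [kissingShell_translate] at hS
    have e : B + (τ' • barlowOffset (2 : ℝ) - layerNormal layerSpacing) = c' + latPt i j := by rw [hB, hc']; abel
    have hmem : τ' • (barlowOffset (2 : ℝ)) - layerNormal layerSpacing ∈ kissingShell {z | B + z ∈ V} 0 :=
      hWS ▸ mem_layerShell_iff.2 (Or.inr (Or.inr ht))
    have hmem' : B + (τ' • barlowOffset (2 : ℝ) - layerNormal layerSpacing) ∈ V := by simpa using hmem.1
    exact ⟨e ▸ hmem', ρ', hρ', e ▸ hS⟩
  set ρ₀ : ℝ := if c' + (barlowOffset (2 : ℝ) - layerNormal layerSpacing) ∈ V then 1 else -1 with hρ₀def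
  have hρ₀ : ρ₀ = 1 ∨ ρ₀ = -1 := by rw [hρ₀def]; split_ifs <;> simp
  refine ⟨ρ₀, hρ₀, ?_⟩
  have key : ∀ i j : ℤ, |i| + |j| ≤ n - 2 → kissingShell V (c' + latPt i j) = layerShell (-τ') ρ₀ := by
    by_cases h00 : (0 : ℤ) ≤ n - 2
    swap
    · intro i j hij; exfalso; have := abs_nonneg i; have := abs_nonneg j; omega
    refine disc_induction (n - 2) ?_ ?_
    · obtain ⟨-, ρ', hρ', hS⟩ := point 0 0 (by simpa using h00)
      rw [hS, lower_type_eq hρ' hS, latPt_zero, add_zero]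
    · intro i j hij hS
      have h1 := abs_add_one_le i; have h2 := abs_sub_one_le i; have h3 := abs_add_one_le j; have h4 := abs_sub_one_le j
      refine ⟨?_, ?_, ?_, ?_⟩
      · obtain ⟨-, ρ', hρ', hS'⟩ := point (i + 1) j (by omega)
        rw [latPt_succ_left, ← add_assoc] at hS' ⊢
        rw [hS', (types_eq_of_adjacent hV (Or.inl rfl) hmτ hρ₀ hmτ hρ' hS hS').2]
      · obtain ⟨-, ρ', hρ', hS'⟩ := point (i - 1) j (by omega)
        have e : c' + latPt (i - 1) j + triangularVec₁ (2 : ℝ) = c' + latPt i j := by rw [latPt_pred_left]; abel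
        rw [hS', ← (types_eq_of_adjacent hV (Or.inl rfl) hmτ hρ' hmτ hρ₀ hS' (e.symm ▸ hS)).2]
      · obtain ⟨-, ρ', hρ', hS'⟩ := point i (j + 1) (by omega)
        rw [latPt_succ_right, ← add_assoc] at hS' ⊢
        rw [hS', (types_eq_of_adjacent hV (Or.inr rfl) hmτ hρ₀ hmτ hρ' hS hS').2]
      · obtain ⟨-, ρ', hρ', hS'⟩ := point i (j - 1) (by omega)
        have e : c' + latPt i (j - 1) + triangularVec₂ (2 : ℝ) = c' + latPt i j := by rw [latPt_pred_right]; abel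
        rw [hS', ← (types_eq_of_adjacent hV (Or.inr rfl) hmτ hρ' hmτ hρ₀ hS' (e.symm ▸ hS)).2]
  exact fun i j h => ⟨(point i j h).1, key i j h⟩

end Summit.Ventures.Crystal3D.Theorems.LocalStacking

end
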